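import Mathlib
import HarnessLib
import HarnessLib.Audit
import Summits.CriticalPhenomena.PercolationContinuityZ3.Theorems.PercNearOneGluingNoHeavyLowerTailHexMSMSEquality
import Summits.CriticalPhenomena.PercolationContinuityZ3.Theorems.PercNearOneGluingNoHeavyLowerTailHexMSMatchPureSCOne

/-!
# Second differences in a Marica–Schönheim-tight two-coloured family (hp-7 gen 72)

Support file for crux `stmt-CriticalPhenomena-4575` (route `PercNearOneGluingNoHeavy`), hull-port seat `prim-hp-7` (generation 72);
`--supports stmt-CriticalPhenomena-4575`.  No `sorry`.  Memo: `run/shared/lean/prim/prim-hp-7/FROM-prim-hp-7-g72-MS2.md` §0.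

THE SECOND-DIFFERENCE REDUCTION of the pure SC inequality (Π2″) (`PureSC`, `…HexMSMatchPureSC`).  Write every blocker representative
as a CROSS DIFFERENCE `d` of the two blocks `P, Q` of `F`: `d = w = p \ q` (type 5) or `d = U \ w = q \ p` (type 2).  The avoidance
hypothesis of (Π2″) says that `d` is a *pure* cross difference — not a difference of two members of the same block — so EVERY pair
`(f, g)` of members with `g \ f = d` is a cross pair (`cross_of_sdiff_eq`).  Of the eight term families of `scTerms` only two are then
needed: `P \\ W ∋ p \ d` and `Q ⊼ W ∋ q ∩ w = q \ d` — SECOND DIFFERENCES `f \ d`.  This file proves the combinatorial core for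
MS-tight `F`; `…HexMSMatchPureSCTight` assembles (Π2″) from it.

* `card_le_card_filter_secondDiff_of_pivot` — **the tight core.**  Let `F = P ∪ Q` satisfy `#(F \\ F) ≤ #F` and have a pivot `c ∈ F`
  (`c ∪ g, c ∩ g ∈ F` for all `g ∈ F`; every nonempty MS-tight family has one, `TwistedAD.exists_pivot_of_card_diffs_eq_card`), and
  let `D ⊆ F \\ F` consist of pure cross differences.  Then at least `#D` MEMBERS `m ∈ F` are double second differences
  `m = p \ d = q \ d` (`p ∈ P`, `q ∈ Q`, `d ∈ D`).
  Proof.  `F` is the twisted product `{(c \ e₁) ∪ e₂}` over the difference-closed families `E₁ = {c \ g}`, `E₂ = {g \ c}`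
  (`…HexMSMSEquality`).  For `d, d' ∈ D` with the same `c`-part put `m := (c ∪ d') \ d ∈ F` (`union_sdiff_mem_of_pivot`).  The three
  pairs `(m, c ∪ d)`, `(c \ d, c ∪ d)`, `(c \ d, c ∪ d')` realise the pure differences `d, d, d'`, so `m` and `c ∪ d'` lie in different
  blocks — and both have second difference `· \ d = m` (`exists_sdiff_eq_witness`).  For a fixed `c`-part `x` the members so obtained
  are `(c \ x) ∪ z` with `z` a difference of two outer parts of elements of `D` over `x`; by Marica–Schönheim on that fibre there are at
  least as many of them as elements of `D` over `x`, and different `x` give different members.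

Behind this (memo §0): the label-free, complement-free SECOND-ORDER MARICA–SCHÖNHEIM inequality (MS2)
`#(F \\ F ∪ P \\ D₅ ∪ Q \\ D₂) ≥ #F + #D₅ + #D₂` for disjoint families `D₅ ⊆ P \\ Q`, `D₂ ⊆ Q \\ P` of pure cross differences
avoiding `F` — a conjecture for general `F` (exact by SAT on `2^[3]`, `2^[4]`, kit `j253579`; 0 failures in `2·10⁵` random trials on
`2^[5]`, `2^[6]`), which this file settles when `F` is MS-tight; it implies (Π2″) for dead-like blocks.
-/

namespace Summit.CriticalPhenomena.PercolationContinuityZ3.Theorems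

namespace GeneratedDonors

open Finset FinsetFamily

variable {α : Type*} [DecidableEq α]

section TightCore

variable {F P Q : Finset (Finset α)} {c : Finset α}

/-- In a tight family with pivot `c`, for every difference `d` the sets `c \ d` and `c ∪ d` are members. -/
theorem sdiff_mem_and_union_mem_of_pivot (hcard : #(F \\ F) ≤ #F) (hc : ∀ g ∈ F, c ∪ g ∈ F ∧ c ∩ g ∈ F) (hcF : c ∈ F)
    {d : Finset α} (hd : d ∈ F \\ F) : c \ d ∈ F ∧ c ∪ d ∈ F := by
  obtain ⟨h1, h2⟩ := mem_diffs_pivot_split hcard hc hd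
  have h0l : c \ c ∈ F.image (c \ ·) := mem_image.mpr ⟨c, hcF, rfl⟩
  have h0r : c \ c ∈ F.image (· \ c) := mem_image.mpr ⟨c, hcF, rfl⟩
  have hu := tp_mem_of_pivot hcard hc (d ∩ c) h1 (c \ c) h0r
  have hv := tp_mem_of_pivot hcard hc (c \ c) h0l (d \ c) h2
  have eu : (c \ (d ∩ c)) ∪ (c \ c) = c \ d := by
    ext i; simp only [mem_union, mem_sdiff, mem_inter]; tauto
  have ev : (c \ (c \ c)) ∪ (d \ c) = c ∪ d := by
    ext i; simp only [mem_union, mem_sdiff]; tauto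
  rw [eu] at hu; rw [ev] at hv
  exact ⟨hu, hv⟩

/-- The witness member.  For differences `d, d'` with the same `c`-part, `(c ∪ d') \ d = (c \ (d ∩ c)) ∪ ((d' \ c) \ (d \ c))`
is a member of the tight family. -/
theorem union_sdiff_mem_of_pivot (hcard : #(F \\ F) ≤ #F) (hc : ∀ g ∈ F, c ∪ g ∈ F ∧ c ∩ g ∈ F)
    {d d' : Finset α} (hd : d ∈ F \\ F) (hd' : d' ∈ F \\ F) (hx : d ∩ c = d' ∩ c) :
    (c ∪ d') \ d ∈ F ∧ (c ∪ d') \ d = (c \ (d ∩ c)) ∪ ((d' \ c) \ (d \ c)) := by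
  obtain ⟨h1, h2⟩ := mem_diffs_pivot_split hcard hc hd
  obtain ⟨-, h2'⟩ := mem_diffs_pivot_split hcard hc hd'
  have hz : (d' \ c) \ (d \ c) ∈ F.image (· \ c) := diffClosed_image_sdiff_right hcard hc _ h2' _ h2
  have hm := tp_mem_of_pivot hcard hc (d ∩ c) h1 _ hz
  have heq : (c ∪ d') \ d = (c \ (d ∩ c)) ∪ ((d' \ c) \ (d \ c)) := by
    ext i
    simp only [mem_sdiff, mem_union, mem_inter]
    have hxi : i ∈ d ∩ c ↔ i ∈ d' ∩ c := by rw [hx]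
    simp only [mem_inter] at hxi
    tauto
  exact ⟨heq ▸ hm, heq⟩

/-- PURE CROSS DIFFERENCES force cross pairs: if `F = P ∪ Q` and `d` is not a within-block difference, then for members `f, g`
with `g \ f = d` exactly one of `f, g` lies in `P`. -/
theorem cross_of_sdiff_eq (hF : F = P ∪ Q) {d : Finset α} (hdP : d ∉ P \\ P) (hdQ : d ∉ Q \\ Q)
    {f g : Finset α} (hf : f ∈ F) (hg : g ∈ F) (hgf : g \ f = d) : (f ∈ P ↔ g ∉ P) := by
  rw [hF] at hf hg
  constructor
  · intro hfP hgP
    exact hdP (mem_diffs.mpr ⟨g, hgP, f, hfP, hgf⟩)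
  · intro hgP
    by_contra hfP
    have hfQ : f ∈ Q := (mem_union.mp hf).resolve_left hfP
    have hgQ : g ∈ Q := (mem_union.mp hg).resolve_left hgP
    exact hdQ (mem_diffs.mpr ⟨g, hgQ, f, hfQ, hgf⟩)

set_option maxHeartbeats 400000 in
/-- **The double second difference.**  `F = P ∪ Q` tight with pivot `c`; `d, d'` pure cross differences with the same `c`-part.
Then the member `m = (c ∪ d') \ d` is `p \ d` for some `p ∈ P` AND `q \ d` for some `q ∈ Q` (namely `{p, q} = {m, c ∪ d'}`). -/
theorem exists_sdiff_eq_witness (hF : F = P ∪ Q) (hcard : #(F \\ F) ≤ #F)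
    (hc : ∀ g ∈ F, c ∪ g ∈ F ∧ c ∩ g ∈ F) (hcF : c ∈ F) {d d' : Finset α} (hd : d ∈ F \\ F) (hd' : d' ∈ F \\ F)
    (hdP : d ∉ P \\ P) (hdQ : d ∉ Q \\ Q) (hdP' : d' ∉ P \\ P) (hdQ' : d' ∉ Q \\ Q) (hx : d ∩ c = d' ∩ c) :
    (∃ p ∈ P, p \ d = (c ∪ d') \ d) ∧ (∃ q ∈ Q, q \ d = (c ∪ d') \ d) := by
  set m := (c ∪ d') \ d with hmdef
  obtain ⟨hmF, -⟩ := union_sdiff_mem_of_pivot hcard hc hd hd' hx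
  obtain ⟨huF, hvF⟩ := sdiff_mem_and_union_mem_of_pivot hcard hc hcF hd
  obtain ⟨-, hv'F⟩ := sdiff_mem_and_union_mem_of_pivot hcard hc hcF hd'
  -- three realisations
  have r1 : (c ∪ d) \ m = d := by
    rw [hmdef]; ext i; simp only [mem_sdiff, mem_union]
    have hxi : i ∈ d ∩ c ↔ i ∈ d' ∩ c := by rw [hx]
    simp only [mem_inter] at hxi
    tauto
  have r2 : (c ∪ d) \ (c \ d) = d := union_sdiff_sdiff_self c d
  have r3 : (c ∪ d') \ (c \ d) = d' := by
    ext i; simp only [mem_sdiff, mem_union]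
    have hxi : i ∈ d ∩ c ↔ i ∈ d' ∩ c := by rw [hx]
    simp only [mem_inter] at hxi
    tauto
  have c1 := cross_of_sdiff_eq hF hdP hdQ hmF hvF r1
  have c2 := cross_of_sdiff_eq hF hdP hdQ huF hvF r2
  have c3 := cross_of_sdiff_eq hF hdP' hdQ' huF hv'F r3
  -- m and c ∪ d' lie in different blocks; both have second difference m
  have hself : m \ d = m := by
    rw [hmdef]; ext i; simp only [mem_sdiff, mem_union]; tauto
  have hv'Q : c ∪ d' ∉ P → c ∪ d' ∈ Q := fun h => by
    have := hv'F; rw [hF] at this; exact (mem_union.mp this).resolve_left h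
  have hmQ : m ∉ P → m ∈ Q := fun h => by
    have := hmF; rw [hF] at this; exact (mem_union.mp this).resolve_left h
  by_cases hmP : m ∈ P
  · have hv'P : c ∪ d' ∉ P := c3.mp (c2.mpr (c1.mp hmP))
    exact ⟨⟨m, hmP, hself⟩, ⟨c ∪ d', hv'Q hv'P, rfl⟩⟩
  · have hv'P : c ∪ d' ∈ P := by
      by_contra h
      exact hmP (c1.mpr (c2.mp (c3.mpr h)))
    exact ⟨⟨c ∪ d', hv'P, rfl⟩, ⟨m, hmQ hmP, hself⟩⟩

/-- **THE TIGHT CORE.**  `F = P ∪ Q` with `#(F \\ F) ≤ #F` and a pivot `c ∈ F`; `D ⊆ F \\ F` pure cross differences (no element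
of `D` is a within-block difference).  Then at least `#D` members of `F` are double second differences `p \ d = q \ d`
(`p ∈ P`, `q ∈ Q`, `d ∈ D`). -/
theorem card_le_card_filter_secondDiff_of_pivot (hF : F = P ∪ Q) (hcard : #(F \\ F) ≤ #F)
    (hc : ∀ g ∈ F, c ∪ g ∈ F ∧ c ∩ g ∈ F) (hcF : c ∈ F) {D : Finset (Finset α)} (hD : D ⊆ F \\ F)
    (hDP : ∀ d ∈ D, d ∉ P \\ P) (hDQ : ∀ d ∈ D, d ∉ Q \\ Q) :
    #D ≤ #(F.filter fun m => ∃ d ∈ D, (∃ p ∈ P, p \ d = m) ∧ (∃ q ∈ Q, q \ d = m)) := by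
  classical
  set Tm := F.filter fun m => ∃ d ∈ D, (∃ p ∈ P, p \ d = m) ∧ (∃ q ∈ Q, q \ d = m) with hTmdef
  -- fibres of D over the c-part
  set X : Finset (Finset α) := D.image (· ∩ c) with hXdef
  let Dx : Finset α → Finset (Finset α) := fun x => D.filter fun d => d ∩ c = x
  let Yx : Finset α → Finset (Finset α) := fun x => (Dx x).image (· \ c)
  let Wx : Finset α → Finset (Finset α) := fun x => (Yx x \\ Yx x).image fun z => (c \ x) ∪ z
  -- (1) #D = Σ_x #(Dx x)
  have h1 : #D = ∑ x ∈ X, #(Dx x) := card_eq_sum_card_image (· ∩ c) D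
  -- (2) #(Dx x) = #(Yx x): d ↦ d \ c is injective on a fibre
  have h2 : ∀ x ∈ X, #(Dx x) = #(Yx x) := by
    intro x _
    refine (card_image_of_injOn ?_).symm
    intro d hd d₂ hd₂ hdd
    have hd1 := (mem_filter.mp (mem_coe.mp hd)).2
    have hd2 := (mem_filter.mp (mem_coe.mp hd₂)).2
    have e1 : d = (d ∩ c) ∪ (d \ c) := by ext i; simp only [mem_union, mem_inter, mem_sdiff]; tauto
    have e2 : d₂ = (d₂ ∩ c) ∪ (d₂ \ c) := by ext i; simp only [mem_union, mem_inter, mem_sdiff]; tauto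
    rw [e1, e2, hd1, hd2]
    simp only at hdd
    rw [hdd]
  -- (3) #(Yx x) ≤ #(Wx x): Marica–Schönheim on the fibre, and z ↦ (c \ x) ∪ z injective on sets disjoint from c
  have hYdisj : ∀ x, ∀ z ∈ Yx x \\ Yx x, Disjoint z c := by
    intro x z hz
    obtain ⟨a, ha, b, -, rfl⟩ := mem_diffs.mp hz
    obtain ⟨d, -, rfl⟩ := mem_image.mp ha
    exact disjoint_of_subset_left sdiff_subset disjoint_sdiff_self_left
  have h3 : ∀ x ∈ X, #(Yx x) ≤ #(Wx x) := by
    intro x _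
    have hinj : Set.InjOn (fun z => (c \ x) ∪ z) ↑(Yx x \\ Yx x) := by
      intro z hz z₂ hz₂ hzz
      have dz := hYdisj x z (mem_coe.mp hz)
      have dz₂ := hYdisj x z₂ (mem_coe.mp hz₂)
      simp only at hzz
      have k1 : ((c \ x) ∪ z) \ c = z := by
        ext i; simp only [mem_sdiff, mem_union]
        constructor
        · rintro ⟨h | h, hic⟩
          · exact absurd h.1 hic
          · exact h
        · intro h; exact ⟨Or.inr h, fun hic => (Finset.disjoint_left.mp dz) h hic⟩
      have k2 : ((c \ x) ∪ z₂) \ c = z₂ := by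
        ext i; simp only [mem_sdiff, mem_union]
        constructor
        · rintro ⟨h | h, hic⟩
          · exact absurd h.1 hic
          · exact h
        · intro h; exact ⟨Or.inr h, fun hic => (Finset.disjoint_left.mp dz₂) h hic⟩
      rw [← k1, hzz, k2]
    calc #(Yx x) ≤ #(Yx x \\ Yx x) := (Yx x).card_le_card_diffs
      _ = #(Wx x) := (card_image_of_injOn hinj).symm
  -- (4) Wx x ⊆ Tm
  have h4 : ∀ x ∈ X, Wx x ⊆ Tm := by
    intro x _ w hw
    obtain ⟨z, hz, rfl⟩ := mem_image.mp hw
    obtain ⟨a, ha, b, hb, rfl⟩ := mem_diffs.mp hz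
    obtain ⟨d', hd'x, rfl⟩ := mem_image.mp ha
    obtain ⟨d, hdx, rfl⟩ := mem_image.mp hb
    obtain ⟨hd'D, hd'c⟩ := mem_filter.mp hd'x
    obtain ⟨hdD, hdc⟩ := mem_filter.mp hdx
    have hxx : d ∩ c = d' ∩ c := hdc.trans hd'c.symm
    obtain ⟨hmF, hmeq⟩ := union_sdiff_mem_of_pivot hcard hc (hD hdD) (hD hd'D) hxx
    have hw_eq : (c \ x) ∪ ((d' \ c) \ (d \ c)) = (c ∪ d') \ d := by rw [hmeq, hdc]
    rw [hTmdef, mem_filter, hw_eq]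
    exact ⟨hmF, d, hdD, exists_sdiff_eq_witness hF hcard hc hcF (hD hdD) (hD hd'D) (hDP d hdD) (hDQ d hdD)
      (hDP d' hd'D) (hDQ d' hd'D) hxx⟩
  -- (5) the Wx are pairwise disjoint: c \ w = x recovers the fibre
  have hrecover : ∀ x ∈ X, ∀ w ∈ Wx x, c \ w = x := by
    intro x hx w hw
    obtain ⟨z, hz, rfl⟩ := mem_image.mp hw
    have dz := hYdisj x z hz
    obtain ⟨d, -, rfl⟩ := mem_image.mp hx
    ext i; simp only [mem_sdiff, mem_union, mem_inter]
    constructor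
    · rintro ⟨hic, h⟩
      refine ⟨?_, hic⟩
      by_contra hid
      exact h (Or.inl ⟨hic, fun hh => hid hh.1⟩)
    · rintro ⟨hid, hic⟩
      exact ⟨hic, fun h => h.elim (fun hh => hh.2 ⟨hid, hic⟩) fun hz' => (Finset.disjoint_left.mp dz) hz' hic⟩
  have h5 : (X : Set (Finset α)).PairwiseDisjoint Wx := by
    intro x hx x' hx' hne
    rw [Function.onFun, Finset.disjoint_left]
    intro w hw hw'
    exact hne ((hrecover x (mem_coe.mp hx) w hw).symm.trans (hrecover x' (mem_coe.mp hx') w hw'))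
  -- assemble
  calc #D = ∑ x ∈ X, #(Dx x) := h1
    _ ≤ ∑ x ∈ X, #(Wx x) := sum_le_sum fun x hx => (h2 x hx).le.trans (h3 x hx)
    _ = #(X.biUnion Wx) := (card_biUnion h5).symm
    _ ≤ #Tm := card_le_card (biUnion_subset.mpr h4)

end TightCore

end GeneratedDonors

end Summit.CriticalPhenomena.PercolationContinuityZ3.Theorems
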